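import Literature.AnabelianGeometry.SemiGraphs.TemperedPersistentFixedSystem
import Literature.AnabelianGeometry.SemiGraphs.TemperedLevelTreesLocallyFinite
import HarnessLib

/-!
# [SemiAnbd] Thm 3.7 (iii), first sentence at a LOCALLY FINITE `𝒢`: PERSISTENT ⇔ VERTICIAL and the
# per-subgroup ESCAPE DICHOTOMY at the canonical tower `𝒢_{∞,j}` (binder-free, every subgroup)

Mochizuki, *Semi-graphs of anabelioids*, Publ. RIMS **42** (2006), §3, Theorem 3.7 (iii), author's
manuscript pp. 40–41 [cite: MochizukiSemiAnbd2006, Thm 3.7(iii) pp.40-41]: "any compact subgroup of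
`π₁^temp(𝒢)` is contained in at least one verticial subgroup"; proof p. 41: "`H` fixes at least one vertex
of `𝒢_{∞,i}` … we may assume that there exists a compatible system of vertices of `𝒢_{∞,j}`, for `j ∈ J`,
each of which is fixed by `H`".

PROOF-ONLY file (cell abc-iut, layer L3, GAP row G-t6g3-2 «Thm 3.7 (iii) beyond finite `𝔾`»; seat
abc-iut-L3-t8 gen 6, row «PERSISTENT⇒VERTICIAL / ESCAPE-DICHOTOMY», brick 2; no definition).  The binders of
`TemperedPersistentFixedSystem.lean` are DISCHARGED at the level data of record
`verticialLevelData_temperedPiChart` of the constructed chart (the trees `𝒢_{∞,j} = 𝔾̃_j` of the canonical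
tower of Prop. 3.6) for every countable LOCALLY FINITE `𝒢` satisfying the hypotheses of Thm 3.7:
(LE_C,w) = abc-iut-w6-d062's `localLevelEstranged_temperedPiChart` (`TemperedHbddOfLocallyFinite.lean`),
`hlocfin` = abc-iut-w6-d120's `hlocfin_verticialLevelData_temperedPiChart`
(`TemperedLevelTreesLocallyFinite.lean`), finite stars of base vertices = `finite_starNeighbours_of_isLocallyFinite`.
THEOREM OF RECORD for COMPACT `C ≠ 1` and for the global statements (`CompactInVerticialAt 𝒢` from
persistence; the dichotomy «(iii) AT `𝒢` or a nontrivial compact subgroup escapes horizontally»):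
abc-iut-w6-d066's `TemperedCompactInVerticialAtOfPersistentLocFin.lean` (p451218; another route).  The
statements here are the PER-SUBGROUP forms for an ARBITRARY subgroup (no compactness):

* `exists_verticial_ge_of_persistent_temperedPiChart` — **PERSISTENT ⇒ VERTICIAL**: a subgroup
  `C ≤ π₁^temp(𝒢)` for which ONE vertex `u` of `𝔾` carries a `C`-fixed vertex of `𝒢_{∞,k}` at every
  level `k` lies in a verticial subgroup (hence is relatively compact);
  `le_verticial_iff_exists_persistent_temperedPiChart` — the characterisation of the subgroups of
  verticial subgroups;
* `le_verticial_or_forall_finite_escape_temperedPiChart` — **ESCAPE DICHOTOMY**: every subgroup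
  `C ≤ π₁^temp(𝒢)` EITHER lies in a verticial subgroup OR, for every FINITE set `S` of vertices of `𝔾`,
  some level `𝒢_{∞,k}` carries no `C`-fixed vertex over `S` — the violators of the existence sentence are
  exactly the subgroups whose level-fixed loci «escape to infinity» (as along the ray of `𝒢_θ`,
  abc-iut-L3-d1, abc-iut-L3-d4; for compact `C` the escape runs along a RAY of `𝔾` by abc-iut-w6-d066's
  `exists_ray_of_horizontalEscape`).

Nothing here asserts the existence sentence for all compact subgroups of all locally finite `𝒢` (false at
`𝒢_θ`, `ThetaRayRefutation.lean`); nothing here bears on [IUTchIII] Cor. 3.12; typed ≠ proved elsewhere.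
-/

namespace Literature.AnabelianGeometry.SemiGraphs

namespace ProfiniteSemiGraph

open CategoryTheory Topology

universe u

variable (𝒢 : ProfiniteSemiGraph.{u})

/-- At a locally finite `𝔾`, the closed star of a vertex `u` meets finitely many vertices: the abutments of
the branches of the finitely many edges at `u`. [cite: MochizukiSemiAnbd2006, §1 p.13] -/
theorem finite_starNeighbours_of_isLocallyFinite (hlf : 𝒢.graph.IsLocallyFinite) (u : 𝒢.graph.Vertex) :
    {w : 𝒢.graph.Vertex | ∃ b b' : 𝒢.graph.Branch, 𝒢.graph.edgeOf b = 𝒢.graph.edgeOf b' ∧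
      𝒢.graph.abuts b = some u ∧ 𝒢.graph.abuts b' = some w}.Finite := by
  have hB : ∀ e : 𝒢.graph.Edge, {b' : 𝒢.graph.Branch | 𝒢.graph.edgeOf b' = e}.Finite := fun e => by
    obtain ⟨b₁, b₂, -, -, -, hall⟩ := 𝒢.graph.two_branches e
    exact ((Set.finite_singleton b₂).insert b₁).subset fun b hb => by
      rcases hall b hb with rfl | rfl
      · exact Set.mem_insert _ _
      · exact Set.mem_insert_of_mem _ rfl
  refine (((hlf.finite_edges u).biUnion fun e _ => (hB e).image fun b' => (𝒢.graph.abuts b').getD u)).subset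
    ?_
  rintro w ⟨b, b', he, hb, hb'⟩
  refine Set.mem_biUnion (x := 𝒢.graph.edgeOf b) ⟨b, rfl, hb⟩ ⟨b', he.symm, ?_⟩
  simp [hb']

/-- **PERSISTENT ⇒ VERTICIAL at the canonical tower** ([SemiAnbd] Thm 3.7 (iii), first sentence, localised;
`𝒢` countable, locally finite, hypotheses of Thm 3.7): a subgroup `C` of the constructed `π₁^temp(𝒢)` — not
assumed compact — such that ONE vertex `u` of `𝔾` carries a `C`-fixed vertex of the tree `𝒢_{∞,k}` at EVERY
level `k` is contained in a verticial subgroup. [cite: MochizukiSemiAnbd2006, Thm 3.7(iii) pp.40-41] -/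
theorem exists_verticial_ge_of_persistent_temperedPiChart (h37 : 𝒢.Thm37Hypotheses)
    (hlf : 𝒢.graph.IsLocallyFinite) (C : Subgroup (𝒢.temperedPiChart h37.toProp36Hypotheses).G)
    (u : 𝒢.graph.Vertex)
    (hpers : ∀ k : ℕ,
      ∃ y : ((verticialLevelData_temperedPiChart (h36 := h37.toProp36Hypotheses)).tree k).Vertex,
        ((verticialLevelData_temperedPiChart (h36 := h37.toProp36Hypotheses)).proj k).vertexMap y = u ∧
        ∀ g ∈ C, ((verticialLevelData_temperedPiChart (h36 := h37.toProp36Hypotheses)).act k g).hom.vertexMap y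
          = y) :
    ∃ (v : 𝒢.graph.Vertex) (H : Subgroup (𝒢.temperedPiChart h37.toProp36Hypotheses).G),
      H ∈ verticialSubgroups (𝒢.temperedPiChart h37.toProp36Hypotheses) v ∧ C ≤ H := by
  by_cases hC : C = ⊥
  · subst hC
    obtain ⟨H, hH⟩ := verticialSubgroups_nonempty h37.isQuasiCoherent h37.isGaloisCountable
      (𝒢.temperedPiChart h37.toProp36Hypotheses) u
    exact ⟨u, H, hH, bot_le⟩
  · exact (verticialLevelData_temperedPiChart (h36 := h37.toProp36Hypotheses)).exists_verticial_ge_of_persistent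
      C (fun w j => 𝒢.localLevelEstranged_temperedPiChart h37 hlf C hC w j)
      (𝒢.hlocfin_verticialLevelData_temperedPiChart h37.toProp36Hypotheses hlf) u
      (𝒢.finite_starNeighbours_of_isLocallyFinite hlf u) hpers

/-- **VERTICIAL ⟺ PERSISTENT at the canonical tower** (`𝒢` countable, locally finite, hypotheses of
Thm 3.7): a subgroup of the constructed `π₁^temp(𝒢)` lies in a verticial subgroup iff some vertex of `𝔾`
carries a fixed vertex of `𝒢_{∞,k}` at every level. [cite: MochizukiSemiAnbd2006, Thm 3.7(iii) pp.40-41] -/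
theorem le_verticial_iff_exists_persistent_temperedPiChart (h37 : 𝒢.Thm37Hypotheses)
    (hlf : 𝒢.graph.IsLocallyFinite) (C : Subgroup (𝒢.temperedPiChart h37.toProp36Hypotheses).G) :
    (∃ (v : 𝒢.graph.Vertex) (H : Subgroup (𝒢.temperedPiChart h37.toProp36Hypotheses).G),
      H ∈ verticialSubgroups (𝒢.temperedPiChart h37.toProp36Hypotheses) v ∧ C ≤ H) ↔
    ∃ u : 𝒢.graph.Vertex, ∀ k : ℕ,
      ∃ y : ((verticialLevelData_temperedPiChart (h36 := h37.toProp36Hypotheses)).tree k).Vertex,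
        ((verticialLevelData_temperedPiChart (h36 := h37.toProp36Hypotheses)).proj k).vertexMap y = u ∧
        ∀ g ∈ C, ((verticialLevelData_temperedPiChart (h36 := h37.toProp36Hypotheses)).act k g).hom.vertexMap y
          = y := by
  constructor
  · rintro ⟨v, H, hH, hCH⟩
    exact (verticialLevelData_temperedPiChart (h36 := h37.toProp36Hypotheses)).exists_persistent_of_le_verticial
      C hH hCH
  · rintro ⟨u, hpers⟩
    exact 𝒢.exists_verticial_ge_of_persistent_temperedPiChart h37 hlf C u hpers

/-- **ESCAPE DICHOTOMY at the canonical tower** ([SemiAnbd] Thm 3.7 (iii) p. 41; `𝒢` countable, locally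
finite, hypotheses of Thm 3.7): every subgroup `C` of the constructed `π₁^temp(𝒢)` EITHER lies in a verticial
subgroup OR its level-fixed loci leave every finite part of `𝔾` — for every FINITE set `S` of vertices of
`𝔾` some tree `𝒢_{∞,k}` carries no `C`-fixed vertex over `S`.  (At the countermodel `𝒢_θ` the escaping
compact subgroups realise the second branch along the ray.) [cite: MochizukiSemiAnbd2006, Thm 3.7(iii) pp.40-41] -/
theorem le_verticial_or_forall_finite_escape_temperedPiChart (h37 : 𝒢.Thm37Hypotheses)
    (hlf : 𝒢.graph.IsLocallyFinite) (C : Subgroup (𝒢.temperedPiChart h37.toProp36Hypotheses).G) :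
    (∃ (v : 𝒢.graph.Vertex) (H : Subgroup (𝒢.temperedPiChart h37.toProp36Hypotheses).G),
      H ∈ verticialSubgroups (𝒢.temperedPiChart h37.toProp36Hypotheses) v ∧ C ≤ H) ∨
    ∀ S : Set 𝒢.graph.Vertex, S.Finite → ∃ k : ℕ,
      ∀ y : ((verticialLevelData_temperedPiChart (h36 := h37.toProp36Hypotheses)).tree k).Vertex,
        ((verticialLevelData_temperedPiChart (h36 := h37.toProp36Hypotheses)).proj k).vertexMap y ∈ S →
        ∃ g ∈ C, ((verticialLevelData_temperedPiChart (h36 := h37.toProp36Hypotheses)).act k g).hom.vertexMap y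
          ≠ y := by
  by_cases h : ∃ (v : 𝒢.graph.Vertex) (H : Subgroup (𝒢.temperedPiChart h37.toProp36Hypotheses).G),
      H ∈ verticialSubgroups (𝒢.temperedPiChart h37.toProp36Hypotheses) v ∧ C ≤ H
  · exact Or.inl h
  refine Or.inr fun S hS => ?_
  by_cases hC : C = ⊥
  · subst hC
    obtain ⟨v⟩ := h37.hasVertex
    obtain ⟨H, hH⟩ := verticialSubgroups_nonempty h37.isQuasiCoherent h37.isGaloisCountable
      (𝒢.temperedPiChart h37.toProp36Hypotheses) v
    exact absurd ⟨v, H, hH, bot_le⟩ h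
  exact (verticialLevelData_temperedPiChart (h36 := h37.toProp36Hypotheses)).exists_level_forall_not_fixed_of_forall_not_le
    C (fun w j => 𝒢.localLevelEstranged_temperedPiChart h37 hlf C hC w j)
    (𝒢.hlocfin_verticialLevelData_temperedPiChart h37.toProp36Hypotheses hlf)
    (𝒢.finite_starNeighbours_of_isLocallyFinite hlf) (fun v H hH hle => h ⟨v, H, hH, hle⟩) S hS

end ProfiniteSemiGraph

end Literature.AnabelianGeometry.SemiGraphs
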